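import Summits.HubbardSuperconductivity.HubbardSuperconductivity.Theorems.KkBandLift.Negative.NotKkBandLiftOfThermalShell
import Summits.HubbardSuperconductivity.HubbardSuperconductivity.Theorems.KkBandLift.Negative.ThermalShellWitness
import HarnessLib

/-!
# Route `KkFloor`, crux `KkBandLift` (stmt-HubbardSuperconductivity-10402), NEGATIVE side:
# the THERMAL-SHELL CENSUS — no dissipative lift profile of the pair-penalised pencil has
# extensive Poisson mass at any bounded height

Refuter file (B2b-4 gen 3; HONEST FRAMING: the value here is a THEOREM — the kernel-checked, sharp
form of the "thermal-shell census" barrier-candidate named in the three landed refutations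
`KkFloorKk{BandLift,ZenoShelf,SusceptibilityWindow}Refutation.lean` — NOT summit progress).

Let `H_L = hubbardTorus 2 L 1 U`, `Π_L = L⁻² Δ_d†Δ_d`, `V_L = szSector (2⌊(1-δ)L²/2⌋) 0`,
`E₀(L) = minEnergyOn H_L V_L`, and call `d : ℝ → ℝ` a LIFT PROFILE on `S ⊆ ℝ` at side `L` when every
eigenpair `(λ, φ)`, `φ ∈ V_L ∖ 0`, of `H_L + iyΠ_L` with `y ∈ S` has `Re λ ≥ E₀(L) + d(y)` (the shape
of the route items `KkBandLift` / `KkZenoShelf` / `KkSusceptibilityWindow`, with `d ≡ εL²`,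
`d ≡ εL²` on `[Y,∞)`, `d(y) = κy²L²`).

* `poissonMass_le_of_lift` — the finite-height floor `finiteXFloor` (N1) for an ARBITRARY profile:
  for every unit `φ ∈ V_L` and every height `x > 0`,
  `∫⁻_S d(y)·x/(x²+y²) dy ≤ π((Re⟨φ,H_Lφ⟩ - E₀) + x·Re⟨φ,Π_Lφ⟩)`
  (`lowEnergy_pairOrder_of_band` is its instance `d ≡ εL²`, `S = [Y₁,Y₂]`, `x = 1`).
* `thermalShellCensus` — composed with the thermal-shell witness (`thermalShellWitness`, Koma–Tasaki
  in the canonical sector + entropy budget): for every `U`, every `δ ≥ -1` and every `κ > 0` there is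
  `L₁` such that for all `L ≥ L₁`, ALL heights `x > 0`, ALL sets `S` and ALL lift profiles `d`,
  `∫⁻_S d(y)·x/(x²+y²) dy ≤ κ(1+x)L²`.
  The threshold `L₁` depends on `(U, δ, κ)` only — it is UNIFORM in the profile, the set and the
  height: the Poisson mass of any dissipative spectral lift is `o(L²)` at every bounded height.
* `no_extensive_lift_on_windows` — hence an extensive lift `d ≡ εL²` is impossible, for all large `L`,
  on ANY family of windows `S_L` carrying Poisson mass `≥ η > 0` at heights `x_L ∈ (0, X]`
  (bands `[Y₁,Y₂]`, shelves `[Y,∞)`, fixed windows, and also `L`-DEPENDENT windows);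
  `no_extensive_lift_on_shrinking_window` — the instance `S_L = [b_L/2, b_L]`, `0 < b_L ≤ 1`
  (mass `≥ 1/4` at height `b_L`), i.e. letting the band slide to `y → 0` with `L` is NOT a repair.
* `no_extensive_lift_on_band` — the band instance in THRESHOLD form: for every `U`, `δ ≥ -1`,
  `ε > 0`, `0 ≤ Y₁ < Y₂` the band lift `Re λ ≥ E₀(L) + εL²` on `[Y₁,Y₂]` fails for ALL large `L`
  (the booked verdict `Theorems.KkFloorKkBandLift_refuted : ¬KkBandLift` denies only the existence of
  admissible parameters; it is not restated here).

What the census does NOT exclude (information for the planner's repair decision, not a theorem of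
this file): profiles whose Poisson mass is `o(L²)` at every bounded height but whose `y⁻²`-mass
`∫ d/y²` (what `KkFloorTheorem` converts into pair order) is still `≥ κL²` — necessarily mass
concentrating at `y → 0` on windows of vanishing RELATIVE width, or sub-extensive lifts at `y → 0`;
by second-order perturbation of the ground branch (`Re λ₀(y) - E₀ = O(y²χ_L)`) such an input amounts
to a super-extensive pair susceptibility `χ_L ≫ L²` of `H_L` in the sector, i.e. to the near-degenerate
pair structure the route set out to prove. No item of the route produces it.

Sources: T. Koma, H. Tasaki, Phys. Rev. Lett. 68 (1992) 3248 [KomaTasakiPRL1992];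
T. Ransford, Potential Theory in the Complex Plane (1995) §2.4, Thm 6.4.2 [Ransford1995].
No definitions.
-/

-- the mandated namespace `Summit.<Summit>.<Problem>.Theorems…` repeats `HubbardSuperconductivity`
-- (single-problem summit, D-0017), which the `dupNamespace` linter flags on every declaration
set_option linter.dupNamespace false

noncomputable section

namespace Summit.HubbardSuperconductivity.HubbardSuperconductivity.Theorems.KkBandLift.Negative

open Matrix MeasureTheory
open Literature.MathematicalPhysics.QuantumLattice Literature.Probability.LatticeModels
open Summit.HubbardSuperconductivity.TwTipContinuation.Negative (expect_pairIntensity_nonneg)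
open scoped ComplexOrder ENNReal

/-- **Finite-height floor for an arbitrary lift profile, on the route's pencil.** If every
eigenpair `(λ, φ)`, `φ ∈ V ∖ 0`, `V = szSector (2 N2) 0`, of `H + iy L⁻²Δ_dᴴΔ_d` with `y ∈ S` has
`Re λ ≥ E₀ + d(y)` (`E₀ = minEnergyOn H V`), then for every unit `φ ∈ V` and every `x > 0`,
`∫⁻_S d(y)·x/(x²+y²) ≤ π((Re⟨φ,Hφ⟩ - E₀) + x·L⁻²Re⟨φ,Δ_dᴴΔ_dφ⟩)`. The landed `finiteXFloor` with
the pencil's bookkeeping (Hermitian `H`, nonnegative invariant penalty). [cite: Ransford1995, Thm 6.4.2] -/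
theorem poissonMass_le_of_lift
    (L : ℕ) [NeZero L] (U : ℝ) (N2 : ℕ) (S : Set ℝ) (d : ℝ → ℝ) {x : ℝ} (hx : 0 < x)
    (hlift : ∀ y ∈ S, ∀ φ : Fock (Orb (FermionTorus 2 L)),
      φ ∈ szSector (Λ := FermionTorus 2 L) (2 * N2) 0 → φ ≠ 0 → ∀ lam : ℂ,
        (hubbardTorus 2 L 1 U + (Complex.I * (y : ℂ)) • ((((1 : ℝ) / (L : ℝ) ^ 2 : ℝ) : ℂ) •
          ((pairField dWaveFormFactor L)ᴴ * pairField dWaveFormFactor L))) *ᵥ φ = lam • φ →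
        (hubbardTorus 2 L 1 U).minEnergyOn (szSector (Λ := FermionTorus 2 L) (2 * N2) 0) +
          d y ≤ lam.re)
    {φ : Fock (Orb (FermionTorus 2 L))} (hφV : φ ∈ szSector (Λ := FermionTorus 2 L) (2 * N2) 0)
    (hφ1 : star φ ⬝ᵥ φ = 1) :
    ∫⁻ y in S, ENNReal.ofReal (d y * (x / (x ^ 2 + y ^ 2))) ≤
      ENNReal.ofReal (Real.pi * (((star φ ⬝ᵥ hubbardTorus 2 L 1 U *ᵥ φ).re -
          (hubbardTorus 2 L 1 U).minEnergyOn (szSector (Λ := FermionTorus 2 L) (2 * N2) 0)) +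
        x * ((1 : ℝ) / (L : ℝ) ^ 2 *
          (star φ ⬝ᵥ ((pairField dWaveFormFactor L)ᴴ * pairField dWaveFormFactor L) *ᵥ φ).re))) := by
  set H : Matrix (Finset (Orb (FermionTorus 2 L))) (Finset (Orb (FermionTorus 2 L))) ℂ :=
    hubbardTorus 2 L 1 U with hH
  set P : Matrix (Finset (Orb (FermionTorus 2 L))) (Finset (Orb (FermionTorus 2 L))) ℂ :=
    (pairField dWaveFormFactor L)ᴴ * pairField dWaveFormFactor L with hP
  set B : Matrix (Finset (Orb (FermionTorus 2 L))) (Finset (Orb (FermionTorus 2 L))) ℂ :=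
    ((((1 : ℝ) / (L : ℝ) ^ 2 : ℝ) : ℂ)) • P with hB
  set V : Submodule ℂ (Fock (Orb (FermionTorus 2 L))) :=
    szSector (Λ := FermionTorus 2 L) (2 * N2) 0 with hV
  set E : ℝ := H.minEnergyOn V with hE
  -- hypotheses of the floor
  have hHh : H.IsHermitian := hubbardTorus_isHermitian (hamiltonian_isHermitian_and_commute_holds _) 1 U
  have hPpsd : P.PosSemidef := pairField_conjTranspose_mul_self_posSemidef dWaveFormFactor L
  have hBh : B.IsHermitian :=
    hPpsd.isHermitian.smul (by rw [isSelfAdjoint_iff, Complex.star_def, Complex.conj_ofReal])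
  have hPre : ∀ v : Fock (Orb (FermionTorus 2 L)), 0 ≤ (star v ⬝ᵥ P *ᵥ v).re := fun v =>
    expect_pairIntensity_nonneg L v
  have hBre : ∀ v : Fock (Orb (FermionTorus 2 L)),
      (star v ⬝ᵥ B *ᵥ v).re = (1 : ℝ) / (L : ℝ) ^ 2 * (star v ⬝ᵥ P *ᵥ v).re := by
    intro v
    rw [hB, smul_mulVec, dotProduct_smul, smul_eq_mul, Complex.re_ofReal_mul]
  have hBnonneg : ∀ v : Fock (Orb (FermionTorus 2 L)), 0 ≤ (star v ⬝ᵥ B *ᵥ v).re := by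
    intro v
    rw [hBre]
    exact mul_nonneg (by positivity) (hPre v)
  have hHinv : ∀ v ∈ V, H *ᵥ v ∈ V := fun v hv =>
    Summit.HubbardSuperconductivity.HubbardSuperconductivity.Theorems.hubbardTorus_mulVec_mem_szSector
      2 L 1 U N2 hv
  have hBinv : ∀ v ∈ V, B *ᵥ v ∈ V := by
    intro v hv
    rw [hB, smul_mulVec]
    exact V.smul_mem _
      (Summit.HubbardSuperconductivity.HubbardSuperconductivity.Theorems.BirGroundStateAverageLRO.Softmin.pairPenalty_mulVec_mem_szSector
        L N2 hv)
  have hEle : ∀ v ∈ V, star v ⬝ᵥ v = 1 → E ≤ (star v ⬝ᵥ H *ᵥ v).re := fun v hv hv1 =>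
    minEnergyOn_le_rayleigh_of_mem hHh V hv hv1
  have hEig : ∀ y ∈ S, ∀ v ∈ V, v ≠ 0 → ∀ lam : ℂ,
      (H + (Complex.I * (y : ℂ)) • B) *ᵥ v = lam • v → E + d y ≤ lam.re :=
    fun y hy v hv hv0 lam hlam => hlift y hy v hv hv0 lam hlam
  -- the finite-height floor at height `x` (N1, landed)
  have key := finiteXFloor (Finset (Orb (FermionTorus 2 L))) H B V E x S d hHh hBh hBnonneg hHinv
    hBinv hEle hx hEig φ hφV hφ1
  rw [hBre] at key
  exact key

/-- **THERMAL-SHELL CENSUS.** For every coupling `U`, every `δ ≥ -1` and every `κ > 0` there is `L₁`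
such that for every side `L ≥ L₁`, every height `x > 0`, every set `S ⊆ ℝ` and every lift profile
`d` of the pencil `H_L + iyL⁻²Δ_dᴴΔ_d` on the sector `szSector (2⌊(1-δ)L²/2⌋) 0`
(`Re λ ≥ E₀(L) + d(y)` for all its eigenpairs with `y ∈ S`), the Poisson mass at height `x` obeys
`∫⁻_S d(y)·x/(x²+y²) dy ≤ κ(1+x)L²`. `L₁` depends on `(U, δ, κ)` only (uniform in `d`, `S`, `x`):
feed the thermal-shell unit vector at budget `c = κ/π` (`thermalShellWitness`: energy `≤ E₀ + cL²`,
pair intensity `≤ cL⁴`) to `poissonMass_le_of_lift`. [cite: KomaTasakiPRL1992, Theorem eq. (2), p. 3] -/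
theorem thermalShellCensus (U δ : ℝ) (hδ : -1 ≤ δ) (κ : ℝ) (hκ : 0 < κ) :
    ∃ L₁ : ℕ, ∀ (L : ℕ) [NeZero L], L₁ ≤ L → ∀ x : ℝ, 0 < x → ∀ (S : Set ℝ) (d : ℝ → ℝ),
      (∀ y ∈ S, ∀ φ : Fock (Orb (FermionTorus 2 L)),
        φ ∈ szSector (Λ := FermionTorus 2 L) (2 * ⌊(1 - δ) * (L : ℝ) ^ 2 / 2⌋₊) 0 → φ ≠ 0 →
          ∀ lam : ℂ,
          (hubbardTorus 2 L 1 U + (Complex.I * (y : ℂ)) • ((((1 : ℝ) / (L : ℝ) ^ 2 : ℝ) : ℂ) •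
            ((pairField dWaveFormFactor L)ᴴ * pairField dWaveFormFactor L))) *ᵥ φ = lam • φ →
          (hubbardTorus 2 L 1 U).minEnergyOn
              (szSector (Λ := FermionTorus 2 L) (2 * ⌊(1 - δ) * (L : ℝ) ^ 2 / 2⌋₊) 0) + d y ≤
            lam.re) →
      ∫⁻ y in S, ENNReal.ofReal (d y * (x / (x ^ 2 + y ^ 2))) ≤
        ENNReal.ofReal (κ * (1 + x) * (L : ℝ) ^ 2) := by
  set c : ℝ := κ / Real.pi with hc
  have hcpos : 0 < c := div_pos hκ Real.pi_pos
  obtain ⟨L₁, hL₁⟩ := thermalShellWitness U δ hδ c hcpos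
  refine ⟨L₁, fun L _ hL x hx S d hlift => ?_⟩
  have hLpos : (0 : ℝ) < (L : ℝ) := Nat.cast_pos.2 (Nat.pos_of_ne_zero (NeZero.ne L))
  have hL2 : (0 : ℝ) < (L : ℝ) ^ 2 := by positivity
  obtain ⟨φ, hφV, hφ1, hφE, hφP⟩ := hL₁ L hL
  have key := poissonMass_le_of_lift L U (⌊(1 - δ) * (L : ℝ) ^ 2 / 2⌋₊) S d hx hlift hφV hφ1
  refine key.trans (ENNReal.ofReal_le_ofReal ?_)
  set eH : ℝ := (star φ ⬝ᵥ hubbardTorus 2 L 1 U *ᵥ φ).re -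
      (hubbardTorus 2 L 1 U).minEnergyOn
        (szSector (Λ := FermionTorus 2 L) (2 * ⌊(1 - δ) * (L : ℝ) ^ 2 / 2⌋₊) 0) with heH
  set eP : ℝ := (star φ ⬝ᵥ ((pairField dWaveFormFactor L)ᴴ * pairField dWaveFormFactor L) *ᵥ φ).re
    with heP
  have h1 : eH ≤ c * (L : ℝ) ^ 2 := by rw [heH]; linarith
  have h2 : (1 : ℝ) / (L : ℝ) ^ 2 * eP ≤ c * (L : ℝ) ^ 2 := by
    rw [div_mul_eq_mul_div, one_mul, div_le_iff₀ hL2]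
    calc eP ≤ c * (L : ℝ) ^ 4 := hφP
      _ = c * (L : ℝ) ^ 2 * (L : ℝ) ^ 2 := by ring
  have h3 : x * ((1 : ℝ) / (L : ℝ) ^ 2 * eP) ≤ x * (c * (L : ℝ) ^ 2) :=
    mul_le_mul_of_nonneg_left h2 hx.le
  have h4 : Real.pi * (c * (L : ℝ) ^ 2 + x * (c * (L : ℝ) ^ 2)) = κ * (1 + x) * (L : ℝ) ^ 2 := by
    rw [hc]
    field_simp
  calc Real.pi * (eH + x * ((1 : ℝ) / (L : ℝ) ^ 2 * eP))
      ≤ Real.pi * (c * (L : ℝ) ^ 2 + x * (c * (L : ℝ) ^ 2)) :=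
        mul_le_mul_of_nonneg_left (add_le_add h1 h3) Real.pi_pos.le
    _ = κ * (1 + x) * (L : ℝ) ^ 2 := h4

/-- **No extensive lift on windows of positive Poisson mass.** For every `U`, `δ ≥ -1`, `ε > 0` and
every family of windows `S_L ⊆ ℝ` and heights `0 < x_L ≤ X` with Poisson mass
`∫⁻_{S_L} x_L/(x_L²+y²) dy ≥ η > 0`, for all large `L` the extensive lift FAILS on `S_L`: some
eigenpair `(λ, φ)`, `φ ∈ szSector (2⌊(1-δ)L²/2⌋) 0 ∖ 0`, of `H_L + iyL⁻²Δ_dᴴΔ_d` with `y ∈ S_L` has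
`Re λ < E₀(L) + εL²`. Bands `[Y₁,Y₂]` (`KkBandLift`), shelves `[Y,∞)` (`KkZenoShelf`), fixed windows
(`KkSusceptibilityWindow` via `KkWindowGivesBand`) and `L`-dependent windows at bounded height are all
instances. From `thermalShellCensus` at `κ = εη/(2(1+X))`: `εηL² ≤ εηL²/2`.
[cite: KomaTasakiPRL1992, Theorem eq. (2), p. 3] -/
theorem no_extensive_lift_on_windows (U δ : ℝ) (hδ : -1 ≤ δ) {ε X η : ℝ} (hε : 0 < ε) (hX : 0 < X)
    (hη : 0 < η) (S : ℕ → Set ℝ) (x : ℕ → ℝ) (hx : ∀ L, 0 < x L ∧ x L ≤ X)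
    (hmass : ∀ L, ENNReal.ofReal η ≤ ∫⁻ y in S L, ENNReal.ofReal (x L / (x L ^ 2 + y ^ 2))) :
    ∃ L₁ : ℕ, ∀ (L : ℕ) [NeZero L], L₁ ≤ L →
      ¬ (∀ y ∈ S L, ∀ φ : Fock (Orb (FermionTorus 2 L)),
        φ ∈ szSector (Λ := FermionTorus 2 L) (2 * ⌊(1 - δ) * (L : ℝ) ^ 2 / 2⌋₊) 0 → φ ≠ 0 →
          ∀ lam : ℂ,
          (hubbardTorus 2 L 1 U + (Complex.I * (y : ℂ)) • ((((1 : ℝ) / (L : ℝ) ^ 2 : ℝ) : ℂ) •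
            ((pairField dWaveFormFactor L)ᴴ * pairField dWaveFormFactor L))) *ᵥ φ = lam • φ →
          (hubbardTorus 2 L 1 U).minEnergyOn
              (szSector (Λ := FermionTorus 2 L) (2 * ⌊(1 - δ) * (L : ℝ) ^ 2 / 2⌋₊) 0) +
            ε * (L : ℝ) ^ 2 ≤ lam.re) := by
  set κ : ℝ := ε * η / (2 * (1 + X)) with hκ
  have hκpos : 0 < κ := by rw [hκ]; positivity
  obtain ⟨L₁, hL₁⟩ := thermalShellCensus U δ hδ κ hκpos
  refine ⟨L₁, fun L _ hL hlift => ?_⟩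
  have hLpos : (0 : ℝ) < (L : ℝ) := Nat.cast_pos.2 (Nat.pos_of_ne_zero (NeZero.ne L))
  have hL2 : (0 : ℝ) < (L : ℝ) ^ 2 := by positivity
  obtain ⟨hx0, hxX⟩ := hx L
  -- the census for the constant profile `d ≡ εL²` at height `x_L`
  have key := hL₁ L hL (x L) hx0 (S L) (fun _ => ε * (L : ℝ) ^ 2) hlift
  -- the Poisson mass of the window gives the lower bound `εL²η`
  have hlow : ENNReal.ofReal (ε * (L : ℝ) ^ 2 * η) ≤
      ∫⁻ y in S L, ENNReal.ofReal ((fun _ : ℝ => ε * (L : ℝ) ^ 2) y * (x L / (x L ^ 2 + y ^ 2))) := by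
    have hεL : 0 ≤ ε * (L : ℝ) ^ 2 := by positivity
    calc ENNReal.ofReal (ε * (L : ℝ) ^ 2 * η)
        = ENNReal.ofReal (ε * (L : ℝ) ^ 2) * ENNReal.ofReal η := ENNReal.ofReal_mul hεL
      _ ≤ ENNReal.ofReal (ε * (L : ℝ) ^ 2) *
            ∫⁻ y in S L, ENNReal.ofReal (x L / (x L ^ 2 + y ^ 2)) := by
            gcongr
            exact hmass L
      _ = ∫⁻ y in S L, ENNReal.ofReal (ε * (L : ℝ) ^ 2) * ENNReal.ofReal (x L / (x L ^ 2 + y ^ 2)) :=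
            (lintegral_const_mul' _ _ ENNReal.ofReal_ne_top).symm
      _ = ∫⁻ y in S L, ENNReal.ofReal ((fun _ : ℝ => ε * (L : ℝ) ^ 2) y * (x L / (x L ^ 2 + y ^ 2))) := by
            refine lintegral_congr fun y => ?_
            rw [← ENNReal.ofReal_mul hεL]
  have hfin := hlow.trans key
  have hrhs : 0 ≤ κ * (1 + x L) * (L : ℝ) ^ 2 := by positivity
  rw [ENNReal.ofReal_le_ofReal_iff hrhs] at hfin
  -- `κ(1+x_L) ≤ κ(1+X) = εη/2`
  have hbound : κ * (1 + x L) * (L : ℝ) ^ 2 ≤ ε * η / 2 * (L : ℝ) ^ 2 := by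
    refine mul_le_mul_of_nonneg_right ?_ hL2.le
    calc κ * (1 + x L) ≤ κ * (1 + X) := mul_le_mul_of_nonneg_left (by linarith) hκpos.le
      _ = ε * η / 2 := by rw [hκ]; field_simp
  have hpos : 0 < ε * (L : ℝ) ^ 2 * η := by positivity
  nlinarith

/-- **Sliding the band to `y → 0` is not a repair.** For every `U`, `δ ≥ -1`, `ε > 0` and every
family of windows `[b_L/2, b_L]` with `0 < b_L ≤ 1` — however fast `b_L → 0` — the extensive lift
`Re λ ≥ E₀(L) + εL²` for all sector eigenpairs of `H_L + iyL⁻²Δ_dᴴΔ_d`, `y ∈ [b_L/2, b_L]`, fails for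
all large `L`: the window has Poisson mass `≥ (b_L/2)·(1/(2b_L)) = 1/4` at height `x_L = b_L`, so
`no_extensive_lift_on_windows` applies. [cite: KomaTasakiPRL1992, Theorem eq. (2), p. 3] -/
theorem no_extensive_lift_on_shrinking_window (U δ : ℝ) (hδ : -1 ≤ δ) {ε : ℝ} (hε : 0 < ε)
    (b : ℕ → ℝ) (hb : ∀ L, 0 < b L ∧ b L ≤ 1) :
    ∃ L₁ : ℕ, ∀ (L : ℕ) [NeZero L], L₁ ≤ L →
      ¬ (∀ y ∈ Set.Icc (b L / 2) (b L), ∀ φ : Fock (Orb (FermionTorus 2 L)),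
        φ ∈ szSector (Λ := FermionTorus 2 L) (2 * ⌊(1 - δ) * (L : ℝ) ^ 2 / 2⌋₊) 0 → φ ≠ 0 →
          ∀ lam : ℂ,
          (hubbardTorus 2 L 1 U + (Complex.I * (y : ℂ)) • ((((1 : ℝ) / (L : ℝ) ^ 2 : ℝ) : ℂ) •
            ((pairField dWaveFormFactor L)ᴴ * pairField dWaveFormFactor L))) *ᵥ φ = lam • φ →
          (hubbardTorus 2 L 1 U).minEnergyOn
              (szSector (Λ := FermionTorus 2 L) (2 * ⌊(1 - δ) * (L : ℝ) ^ 2 / 2⌋₊) 0) +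
            ε * (L : ℝ) ^ 2 ≤ lam.re) := by
  refine no_extensive_lift_on_windows U δ hδ (X := 1) (η := 1 / 4) hε one_pos (by norm_num)
    (fun L => Set.Icc (b L / 2) (b L)) b hb fun L => ?_
  obtain ⟨hb0, hb1⟩ := hb L
  -- pointwise on the window: `b/(b²+y²) ≥ 1/(2b)`
  have hconst : ∀ y ∈ Set.Icc (b L / 2) (b L),
      ENNReal.ofReal (1 / (2 * b L)) ≤ ENNReal.ofReal (b L / (b L ^ 2 + y ^ 2)) := by
    intro y hy
    refine ENNReal.ofReal_le_ofReal ?_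
    have hy0 : 0 ≤ y := by linarith [hy.1]
    have hy2 : y ^ 2 ≤ b L ^ 2 := pow_le_pow_left₀ hy0 hy.2 2
    rw [div_le_div_iff₀ (by positivity) (by positivity)]
    nlinarith
  calc ENNReal.ofReal (1 / 4)
      = ENNReal.ofReal (1 / (2 * b L)) * ENNReal.ofReal (b L - b L / 2) := by
        rw [← ENNReal.ofReal_mul (by positivity)]
        congr 1
        field_simp
        ring
    _ = ENNReal.ofReal (1 / (2 * b L)) * volume (Set.Icc (b L / 2) (b L)) := by
        rw [Real.volume_Icc]
    _ = ∫⁻ _ in Set.Icc (b L / 2) (b L), ENNReal.ofReal (1 / (2 * b L)) := by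
        rw [setLIntegral_const]
    _ ≤ ∫⁻ y in Set.Icc (b L / 2) (b L), ENNReal.ofReal (b L / (b L ^ 2 + y ^ 2)) :=
        setLIntegral_mono' measurableSet_Icc fun y hy => hconst y hy

/-- **Uniform failure of the band lift.** For EVERY coupling `U`, every `δ ≥ -1`, every `ε > 0` and
every band `[Y₁,Y₂]`, `0 ≤ Y₁ < Y₂`, there is `L₁` such that for ALL sides `L ≥ L₁` (even or odd)
the extensive band lift fails: some eigenpair `(λ, φ)`, `φ ∈ szSector (2⌊(1-δ)L²/2⌋) 0 ∖ 0`, of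
`H_L + iyL⁻²Δ_dᴴΔ_d` with `y ∈ [Y₁,Y₂]` has `Re λ < E₀(L) + εL²`. This is the threshold form behind
the booked verdict `Theorems.KkFloorKkBandLift_refuted : ¬ KkBandLift` (which only denies the
existence of admissible parameters): the instance `S_L = [Y₁,Y₂]`, `x_L = 1`,
`η = (Y₂-Y₁)/(1+Y₂²)` of `no_extensive_lift_on_windows`. [cite: KomaTasakiPRL1992, Theorem eq. (2), p. 3] -/
theorem no_extensive_lift_on_band (U δ : ℝ) (hδ : -1 ≤ δ) {ε Y₁ Y₂ : ℝ} (hε : 0 < ε)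
    (hY₁ : 0 ≤ Y₁) (hY₁₂ : Y₁ < Y₂) :
    ∃ L₁ : ℕ, ∀ (L : ℕ) [NeZero L], L₁ ≤ L →
      ¬ (∀ y ∈ Set.Icc Y₁ Y₂, ∀ φ : Fock (Orb (FermionTorus 2 L)),
        φ ∈ szSector (Λ := FermionTorus 2 L) (2 * ⌊(1 - δ) * (L : ℝ) ^ 2 / 2⌋₊) 0 → φ ≠ 0 →
          ∀ lam : ℂ,
          (hubbardTorus 2 L 1 U + (Complex.I * (y : ℂ)) • ((((1 : ℝ) / (L : ℝ) ^ 2 : ℝ) : ℂ) •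
            ((pairField dWaveFormFactor L)ᴴ * pairField dWaveFormFactor L))) *ᵥ φ = lam • φ →
          (hubbardTorus 2 L 1 U).minEnergyOn
              (szSector (Λ := FermionTorus 2 L) (2 * ⌊(1 - δ) * (L : ℝ) ^ 2 / 2⌋₊) 0) +
            ε * (L : ℝ) ^ 2 ≤ lam.re) := by
  have hY₂ : 0 < Y₂ := hY₁.trans_lt hY₁₂
  have hη : 0 < (Y₂ - Y₁) / (1 + Y₂ ^ 2) := div_pos (sub_pos.2 hY₁₂) (by positivity)
  -- Poisson mass of the band at height 1
  have hmass : ∀ L : ℕ, ENNReal.ofReal ((Y₂ - Y₁) / (1 + Y₂ ^ 2)) ≤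
      ∫⁻ y in Set.Icc Y₁ Y₂, ENNReal.ofReal ((fun _ : ℕ => (1 : ℝ)) L /
        ((fun _ : ℕ => (1 : ℝ)) L ^ 2 + y ^ 2)) := by
    intro L
    have hconst : ∀ y ∈ Set.Icc Y₁ Y₂,
        ENNReal.ofReal (1 / (1 + Y₂ ^ 2)) ≤ ENNReal.ofReal ((1 : ℝ) / ((1 : ℝ) ^ 2 + y ^ 2)) := by
      intro y hy
      have hy0 : 0 ≤ y := hY₁.trans hy.1
      refine ENNReal.ofReal_le_ofReal ?_
      rw [one_pow]
      refine div_le_div_of_nonneg_left zero_le_one (by positivity) ?_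
      nlinarith [pow_le_pow_left₀ hy0 hy.2 2]
    calc ENNReal.ofReal ((Y₂ - Y₁) / (1 + Y₂ ^ 2))
        = ENNReal.ofReal (1 / (1 + Y₂ ^ 2)) * ENNReal.ofReal (Y₂ - Y₁) := by
          rw [← ENNReal.ofReal_mul (by positivity)]
          congr 1
          field_simp
      _ = ENNReal.ofReal (1 / (1 + Y₂ ^ 2)) * volume (Set.Icc Y₁ Y₂) := by rw [Real.volume_Icc]
      _ = ∫⁻ _ in Set.Icc Y₁ Y₂, ENNReal.ofReal (1 / (1 + Y₂ ^ 2)) := by rw [setLIntegral_const]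
      _ ≤ ∫⁻ y in Set.Icc Y₁ Y₂, ENNReal.ofReal ((1 : ℝ) / ((1 : ℝ) ^ 2 + y ^ 2)) :=
          setLIntegral_mono' measurableSet_Icc fun y hy => hconst y hy
  exact no_extensive_lift_on_windows U δ hδ (X := 1) hε one_pos hη (fun _ => Set.Icc Y₁ Y₂)
    (fun _ => (1 : ℝ)) (fun _ => ⟨one_pos, le_rfl⟩) hmass

end Summit.HubbardSuperconductivity.HubbardSuperconductivity.Theorems.KkBandLift.Negative

end
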